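import Literature.Computation.Certificates.GramSOS
import Literature.Computation.Certificates.PosSemidefInt

/-!
# Gram-form SOS certificates, ROW-WISE evaluation and PSD facts in any form (`decide +kernel`)

Compute-infrastructure file extending `Certificates/GramSOS.lean` (cell gridfusion, seat sos-5;
same discipline as unit `infra-psd-sos-lp-checker`). Two measured kernel-budget problems of the
one-shot Gram checker `SOS.Poly.checkG` / `nonneg_of_validG` at basis sizes `s ≥ 50` and their
remedies:

* **The residual zero-test.** `GramSOS.poly` builds the FLAT list of the `s²` products
  `Q_ab · m_a m_b` and normalises it in one go; inside one `decide +kernel` (one kernel reduction,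
  whose cache keeps every intermediate list) this exceeds the farm's memory cap between `s = 35`
  (34 s, fine) and `s = 56` ("failed to reduce to `isTrue`/`isFalse`", measured 2026-08-26 on
  synthetic exact certificates, 5–6 variables, degree 6). `GramSOS.polyR` here computes the SAME
  polynomial row by row, `Σ_a m_a · (Σ_b Q_ab m_b)`, folding the `s` normalised row products with
  `Poly.add`: every intermediate list has at most as many terms as the final polynomial, so work
  and memory are `O(s · T)` instead of `O(s² · T)`; `eval_polyR : g.polyR.eval x = g.poly.eval x`.
  `Poly.residualGR` / `checkGR` / `nonneg_of_checkGR` / `nonneg_of_validGR` are the row-wise twins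
  of `residualG` / `checkG` / `nonneg_of_checkG` / `nonneg_of_validG` with identical statements.
* **The PSD sub-certificates.** `GramSOS.Valid` is the rounded rational certificate
  `PSD.IsGramCertDD Q d B`; the integer path of `PosSemidefInt.lean` (`PSD.IsGramCertZ`, ≈ 3×
  cheaper in the kernel) or any other proof of positive semidefiniteness could not be fed to
  `nonneg_of_validG`. `GramSOS.QuadNonneg g R` (the quadratic form of `Q` is nonnegative on
  `Fin s → R`) is the form-agnostic hypothesis: `Valid → QuadNonneg` (`quadNonneg_of_valid`), the
  integer bridge `quadNonneg_of_gramCertZ` (`A = c • Q` entrywise, `0 < c`, `IsGramCertZ A d B`),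
  and the soundness theorems `nonneg_of_quadGR` (row-wise residual) / `nonneg_of_quadG` (classic
  residual) taking one `QuadNonneg` per Gram block.

Statements conclude, exactly as in `GramSOS.lean`, `0 ≤ p.eval x` at every point `x : ℕ → R` of a
linearly ordered field where the hypotheses `g ≥ 0`, `h = 0` hold. Kernel-checked `example`s at the
end (the `GramSOS.lean` tests re-run through the row-wise checker and through the integer path).

References: [cite: BlekhermanParriloThomas2012, Thm 3.39]; [cite: PeyrlParrilo2008, §3].
Not here: no change to the certificate FORMAT (`CertG` is consumed as is); no block-splitting of the
row fold itself (each `decide` is still one identity; split an identity's `p` additively upstream if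
ever needed).
-/

namespace Literature.Computation.Certificates

namespace SOS

open Poly

namespace GramSOS

/-- Row `a` of the Gram polynomial: `m_a · (Σ_b Q_ab m_b)` with the inner sum normalised (at most
`s` terms). [cite: BlekhermanParriloThomas2012, Thm 3.39] -/
def rowPoly (g : GramSOS) (a : Fin g.s) : Poly :=
  Poly.mulTerm (g.mb a) 1 (Poly.norm ((List.finRange g.s).map fun b => (g.mb b, g.Q a b)))

/-- **Row-wise Gram polynomial** `Σ_a m_a · (Σ_b Q_ab m_b)`: the `s` row products folded with
`Poly.add` (sorted merge), so that no intermediate term list is longer than the result — the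
kernel-friendly twin of `GramSOS.poly`. [cite: BlekhermanParriloThomas2012, Thm 3.39] -/
def polyR (g : GramSOS) : Poly :=
  (List.finRange g.s).foldr (fun a acc => Poly.add (g.rowPoly a) acc) []

section Eval

variable {R : Type*} [Field R] [CharZero R]

/-- `eval` of a right fold of `Poly.add` is the sum of the `eval`s (plumbing for `polyR`).
[cite: BlekhermanParriloThomas2012, Thm 3.39] -/
theorem _root_.Literature.Computation.Certificates.SOS.Poly.eval_foldr_add {α : Type*} (x : ℕ → R)
    (f : α → Poly) : ∀ l : List α,
    Poly.eval x (l.foldr (fun a acc => Poly.add (f a) acc) []) = (l.map fun a => Poly.eval x (f a)).sum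
  | [] => by simp
  | a :: l => by
      rw [List.foldr_cons, Poly.eval_add, Poly.eval_foldr_add x f l, List.map_cons, List.sum_cons]

/-- Semantics of one row of the Gram form `m(x)ᵀ Q m(x)`: `(rowPoly a)(x) = Σ_b m_a(x) m_b(x) Q_ab`.
[cite: BlekhermanParriloThomas2012, Thm 3.39] -/
theorem eval_rowPoly (g : GramSOS) (x : ℕ → R) (a : Fin g.s) :
    (g.rowPoly a).eval x = ∑ b, (g.mb a).eval x * (g.mb b).eval x * (g.Q a b : R) := by
  rw [rowPoly, Poly.eval_mulTerm, Poly.eval_norm, Poly.eval_map_term, ← Fin.sum_univ_def,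
    Rat.cast_one, one_mul, Finset.mul_sum]
  exact Finset.sum_congr rfl fun b _ => by ring

/-- **The row-wise Gram polynomial has the same values as `GramSOS.poly`.**
[cite: BlekhermanParriloThomas2012, Thm 3.39] -/
theorem eval_polyR (g : GramSOS) (x : ℕ → R) : g.polyR.eval x = g.poly.eval x := by
  rw [polyR, Poly.eval_foldr_add, ← Fin.sum_univ_def, eval_poly]
  exact Finset.sum_congr rfl fun a _ => g.eval_rowPoly x a

end Eval

section Ordered

variable {R : Type*} [Field R] [LinearOrder R] [IsStrictOrderedRing R]

/-- **Form-agnostic PSD hypothesis** for a Gram block: the quadratic form of `Q` is nonnegative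
on `Fin s → R`. Supplied by `quadNonneg_of_valid` (rounded rational certificate), by
`quadNonneg_of_gramCertZ` (scaled integer certificate), or by any other means (positive
semidefiniteness of the Gram matrix as in the Gram-matrix method). [cite: BlekhermanParriloThomas2012, Thm 3.39] -/
def QuadNonneg (g : GramSOS) (R : Type*) [Field R] [LinearOrder R] [IsStrictOrderedRing R] : Prop :=
  ∀ y : Fin g.s → R, 0 ≤ ∑ a, ∑ b, y a * y b * (g.Q a b : R)

/-- A valid rounded (`LDLᵀ`-type) certificate gives the form-agnostic hypothesis.
[cite: BlekhermanParriloThomas2012, App. A.1.2] -/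
theorem quadNonneg_of_valid (g : GramSOS) (h : g.Valid) : g.QuadNonneg R :=
  fun y => (h : PSD.IsGramCertDD g.Q g.d g.B).quadForm_nonneg' y

/-- **Integer bridge**: an integer rounded Gram certificate `IsGramCertZ A d B` of a positive
multiple `A = c • Q` (entrywise, `0 < c`; a decidable side condition) gives the form-agnostic
hypothesis for the rational Gram block (PSD is invariant under positive scaling).
[cite: BlekhermanParriloThomas2012, App. A.1.2] -/
theorem quadNonneg_of_gramCertZ (g : GramSOS) {m : ℕ} {A : Matrix (Fin g.s) (Fin g.s) ℤ}
    {d : Fin m → ℕ} {B : Matrix (Fin m) (Fin g.s) ℤ} (h : PSD.IsGramCertZ A d B) {c : ℚ}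
    (hc : 0 < c) (hA : ∀ i j, (A i j : ℚ) = c * g.Q i j) : g.QuadNonneg R := by
  intro y
  have h1 := h.quadForm_nonneg_of_smul hc hA y
  convert h1 using 2 with i _
  exact Finset.sum_congr rfl fun j _ => by ring

/-- A Gram block with nonnegative quadratic form is a nonnegative polynomial (classic flat
evaluation). [cite: BlekhermanParriloThomas2012, Thm 3.39] -/
theorem eval_poly_nonneg_of_quadNonneg (g : GramSOS) (h : g.QuadNonneg R) (x : ℕ → R) :
    0 ≤ g.poly.eval x := by
  rw [eval_poly]
  exact h fun a => (g.mb a).eval x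

/-- The same for the row-wise evaluation. [cite: BlekhermanParriloThomas2012, Thm 3.39] -/
theorem eval_polyR_nonneg_of_quadNonneg (g : GramSOS) (h : g.QuadNonneg R) (x : ℕ → R) :
    0 ≤ g.polyR.eval x := by
  rw [eval_polyR]
  exact g.eval_poly_nonneg_of_quadNonneg h x

end Ordered

end GramSOS

namespace Poly

section CharZero

variable {R : Type*} [Field R] [CharZero R]

/-- Row-wise twin of `ineqPartG`: `Σ_i g_i · σ_i` with the multipliers evaluated by `polyR`.
[cite: BlekhermanParriloThomas2012, Thm 3.127] -/
def ineqPartGR : List Poly → List GramSOS → Poly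
  | g :: gs, σ :: σs => add (mul (norm g) σ.polyR) (ineqPartGR gs σs)
  | _, _ => []

/-- `ineqPartGR` and `ineqPartG` have the same values. [cite: BlekhermanParriloThomas2012, Thm 3.127] -/
theorem eval_ineqPartGR (x : ℕ → R) :
    ∀ (gs : List Poly) (σs : List GramSOS), eval x (ineqPartGR gs σs) = eval x (ineqPartG gs σs)
  | g :: gs, σ :: σs => by
      rw [ineqPartGR, ineqPartG, eval_add, eval_add, eval_mul, eval_mul, σ.eval_polyR,
        eval_ineqPartGR x gs σs]
  | [], [] => rfl
  | [], _ :: _ => rfl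
  | _ :: _, [] => rfl

/-- Row-wise twin of `residualG`: `p − (σ₀ + Σ gᵢσᵢ + Σ hⱼtⱼ)` with every Gram block evaluated
by `polyR`. [cite: BlekhermanParriloThomas2012, Thm 3.127] -/
def residualGR (p : Poly) (gs hs : List Poly) (cert : CertG) : Poly :=
  add (norm p) (neg (add cert.free.polyR (add (ineqPartGR gs cert.ineqMult) (eqPart hs cert.eqMult))))

/-- `residualGR` and `residualG` have the same values. [cite: BlekhermanParriloThomas2012, Thm 3.127] -/
theorem eval_residualGR (x : ℕ → R) (p : Poly) (gs hs : List Poly) (cert : CertG) :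
    eval x (residualGR p gs hs cert) = eval x (residualG p gs hs cert) := by
  rw [residualGR, residualG, eval_add, eval_add, eval_neg, eval_neg, eval_add, eval_add, eval_add,
    eval_add, cert.free.eval_polyR, eval_ineqPartGR]

/-- **Row-wise Gram-form checker** (same acceptance as `checkG`, kernel-friendly residual):
every Gram block passes its rounded PSD check and the row-wise residual is the zero polynomial.
[cite: BlekhermanParriloThomas2012, Thm 3.127] -/
def checkGR (p : Poly) (gs hs : List Poly) (cert : CertG) : Bool :=
  cert.free.ok && cert.ineqMult.all GramSOS.ok && isZero (residualGR p gs hs cert)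

end CharZero

section Ordered

variable {R : Type*} [Field R] [LinearOrder R] [IsStrictOrderedRing R]

/-- The inequality part is nonnegative wherever the hypotheses hold, from form-agnostic PSD
hypotheses on the multipliers. [cite: BlekhermanParriloThomas2012, Thm 3.127] -/
theorem eval_ineqPartG_nonneg_of_quadNonneg (x : ℕ → R) :
    ∀ (gs : List Poly) (σs : List GramSOS), (∀ g ∈ gs, 0 ≤ eval x g) →
      (∀ σ ∈ σs, σ.QuadNonneg R) → 0 ≤ eval x (ineqPartG gs σs)
  | g :: gs, σ :: σs, hg, hσ => by
      rw [ineqPartG, eval_add, eval_mul, eval_norm]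
      exact add_nonneg
        (mul_nonneg (hg g List.mem_cons_self)
          (σ.eval_poly_nonneg_of_quadNonneg (hσ σ List.mem_cons_self) x))
        (eval_ineqPartG_nonneg_of_quadNonneg x gs σs (fun g' hg' => hg g' (List.mem_cons_of_mem _ hg'))
          (fun σ' hσ' => hσ σ' (List.mem_cons_of_mem _ hσ')))
  | [], _, _, _ => by simp [ineqPartG]
  | _ :: _, [], _, _ => by simp [ineqPartG]

/-- **Soundness from form-agnostic PSD hypotheses, classic residual**: one `QuadNonneg` per Gram
block (however obtained) plus the zero test of `residualG` give `p(x) ≥ 0` under the hypotheses.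
[cite: BlekhermanParriloThomas2012, Thm 3.127] -/
theorem nonneg_of_quadG {p : Poly} {gs hs : List Poly} {cert : CertG}
    (hf : cert.free.QuadNonneg R) (hσ : ∀ σ ∈ cert.ineqMult, σ.QuadNonneg R)
    (hz : isZero (residualG p gs hs cert) = true)
    (x : ℕ → R) (hg : ∀ g ∈ gs, 0 ≤ eval x g) (hh : ∀ h ∈ hs, eval x h = 0) : 0 ≤ eval x p := by
  have h0 := eval_eq_zero_of_isZero x hz
  rw [residualG, eval_add, eval_norm, eval_neg, eval_add, eval_add] at h0
  have h1 := cert.free.eval_poly_nonneg_of_quadNonneg hf x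
  have h2 := eval_ineqPartG_nonneg_of_quadNonneg x gs cert.ineqMult hg hσ
  have h3 := eval_eqPart x hs cert.eqMult hh
  linarith

/-- **Soundness from form-agnostic PSD hypotheses, ROW-WISE residual** (the scalable entry point:
PSD facts from `quadNonneg_of_valid` / `quadNonneg_of_gramCertZ` / block-split certificates, and
the kernel-friendly zero test of `residualGR`). [cite: BlekhermanParriloThomas2012, Thm 3.127] -/
theorem nonneg_of_quadGR {p : Poly} {gs hs : List Poly} {cert : CertG}
    (hf : cert.free.QuadNonneg R) (hσ : ∀ σ ∈ cert.ineqMult, σ.QuadNonneg R)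
    (hz : isZero (residualGR p gs hs cert) = true)
    (x : ℕ → R) (hg : ∀ g ∈ gs, 0 ≤ eval x g) (hh : ∀ h ∈ hs, eval x h = 0) : 0 ≤ eval x p := by
  have h0 := eval_eq_zero_of_isZero x hz
  rw [eval_residualGR, residualG, eval_add, eval_norm, eval_neg, eval_add, eval_add] at h0
  have h1 := cert.free.eval_poly_nonneg_of_quadNonneg hf x
  have h2 := eval_ineqPartG_nonneg_of_quadNonneg x gs cert.ineqMult hg hσ
  have h3 := eval_eqPart x hs cert.eqMult hh
  linarith

/-- **Soundness, decomposed row-wise form** (rounded rational PSD certificates as separate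
`Prop` hypotheses — each its own, possibly block-split, `decide +kernel` — plus the row-wise
residual zero test). Same statement as `nonneg_of_validG`. [cite: BlekhermanParriloThomas2012, Thm 3.127] -/
theorem nonneg_of_validGR {p : Poly} {gs hs : List Poly} {cert : CertG} (hf : cert.free.Valid)
    (hσ : ∀ σ ∈ cert.ineqMult, σ.Valid) (hz : isZero (residualGR p gs hs cert) = true)
    (x : ℕ → R) (hg : ∀ g ∈ gs, 0 ≤ eval x g) (hh : ∀ h ∈ hs, eval x h = 0) : 0 ≤ eval x p :=
  nonneg_of_quadGR (cert.free.quadNonneg_of_valid hf) (fun σ h => σ.quadNonneg_of_valid (hσ σ h))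
    hz x hg hh

/-- **Soundness of the row-wise one-shot checker** `checkGR` (same statement as
`nonneg_of_checkG`). [cite: BlekhermanParriloThomas2012, Thm 3.127] -/
theorem nonneg_of_checkGR {p : Poly} {gs hs : List Poly} {cert : CertG}
    (hc : checkGR p gs hs cert = true) (x : ℕ → R) (hg : ∀ g ∈ gs, 0 ≤ eval x g)
    (hh : ∀ h ∈ hs, eval x h = 0) : 0 ≤ eval x p := by
  simp only [checkGR, Bool.and_eq_true, List.all_eq_true] at hc
  obtain ⟨⟨hf, hσ⟩, hz⟩ := hc
  exact nonneg_of_validGR (GramSOS.valid_of_ok hf) (fun σ h => GramSOS.valid_of_ok (hσ σ h)) hz x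
    hg hh

end Ordered

end Poly

/-! ### Tests / usage templates (kernel-checked) -/

section TestsGR

open Poly

/-- Test (row-wise one-shot checker, the `GramSOS.lean` example): for `t ≥ 0`,
`t³ − t² + t ≥ 0`, Gram multiplier `(1 t) Q (1 t)ᵀ` on `g = t` with a rounded sub-certificate. -/
example (t : ℝ) (ht : 0 ≤ t) : t ^ 2 ≤ t ^ 3 + t := by
  have h := nonneg_of_checkGR
    (p := [(([3] : List ℕ), (1 : ℚ)), (([2] : List ℕ), (-1 : ℚ)), (([1] : List ℕ), (1 : ℚ))])
    (gs := [X 0]) (hs := [])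
    (cert := ⟨⟨0, 0, ![], Matrix.of ![], ![], Matrix.of ![]⟩,
      [⟨2, 2, ![([] : List ℕ), ([1] : List ℕ)], !![1, -1 / 2; -1 / 2, 1], ![1, 7 / 10],
        !![1, -1 / 2; 0, 1]⟩], []⟩)
    (by decide +kernel) (vars [t]) (by simpa using ht) (by simp)
  simp only [eval_cons, eval_nil, Monomial.eval_eq, Monomial.evalFrom_cons, Monomial.evalFrom_nil,
    vars_cons_zero] at h
  push_cast at h
  linarith

/-- Test (decomposed row-wise form `nonneg_of_quadGR` with an INTEGER PSD certificate for the free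
part): `2a² − 2ab + 2b² ≥ 0`, Gram `Q = [[2, -1], [-1, 2]]` in the basis `(a, b)`; the integer
certificate is for `A = 4 • Q = [[8, -4], [-4, 8]]` with `d = (2, 1)`, `B = [[2, -1], [0, 2]]`
(`BᵀDB = [[8, -4], [-4, 6]]`, residual `[[0, 0], [0, 2]]`, diagonally dominant), and the side
condition `A = 4 • Q` is its own `decide`. -/
example (a b : ℝ) : 0 ≤ 2 * a ^ 2 - 2 * a * b + 2 * b ^ 2 := by
  let σ : GramSOS := ⟨2, 2, ![([1] : List ℕ), ([0, 1] : List ℕ)], !![2, -1; -1, 2], ![2, 3 / 2],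
    !![1, -1 / 2; 0, 1]⟩
  have hq : σ.QuadNonneg ℝ :=
    σ.quadNonneg_of_gramCertZ (A := !![8, -4; -4, 8]) (d := ![2, 1]) (B := !![2, -1; 0, 2])
      (c := 4) (by decide +kernel) (by norm_num) (by decide +kernel)
  have h := nonneg_of_quadGR (gs := []) (hs := [])
    (p := [(([2] : List ℕ), (2 : ℚ)), (([1, 1] : List ℕ), (-2 : ℚ)), (([0, 2] : List ℕ), (2 : ℚ))])
    (cert := ⟨σ, [], []⟩) hq (by simp) (by decide +kernel) (vars [a, b]) (by simp) (by simp)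
  simp only [eval_cons, eval_nil, Monomial.eval_eq, Monomial.evalFrom_cons, Monomial.evalFrom_nil,
    vars_cons_zero, vars_cons_succ] at h
  push_cast at h
  linarith

end TestsGR

end SOS

end Literature.Computation.Certificates
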